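import Literature.NumberTheory.LFunctions.ConreyIwaniec2002Thm61Assembly
import Literature.NumberTheory.LFunctions.ConreyIwaniec2002Thm61Generic
import Literature.NumberTheory.LFunctions.ConreyIwaniec2002Thm61ShiftedSum
import HarnessLib

/-!
# Conrey–Iwaniec (2002), Theorem 6.1 (in Corollary 6.2's normalisation), hypothesis-free

B. Conrey, H. Iwaniec, *Spacing of zeros of Hecke `L`-functions and the class number problem*,
Acta Arith. 103 (2002) 259–312, §6, Theorem 6.1 (6.36) and Corollary 6.2 (6.39)
[held text `paper:arxiv-math_0111012`, p0013–p0016]: for an admissible kernel `K` ((6.1)–(6.3)),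
coefficients `λ(n)` with `|λ(n)| ≤ τ(n)` (6.15) satisfying the shifted-convolution asymptotics (6.19)
with constant `B` and main-term coefficients `|σ(h)| ≤ C₁σ₋₁(h)` (6.20), and a cutoff `a` in the
class (6.38) with `2 ≤ T ≤ Y ≤ T⁸`,
`c₀∫_T^{2T}|Σ_n a(n)λ(n)n^{-1/2-it}|²dt ≤ L(0)·T·G + 2T∫₀^∞|a(y)|²D(T/y)dy/y`
`  + c(1+B)^{1/2}(1+C₁)T⁻¹Y^{15/8}(log Y)⁴`,
where `G = Σ_n |a(n)λ(n)|²/n` (6.40), `L(0) = 2∫₀^∞K` (6.6) and the off-diagonal main term is kept as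
the series `D(v) = Σ_h σ(h)L(hv)` (6.29) (its evaluation (6.32)–(6.35) is a separate step).

PROVED HERE: **`ConreyIwaniec2002.theorem61`** — the statement of the parent stub S2
`stub_theorem61` of SKELETON P64 (line `thm61-cm-convolution`, cell `landau-siegel/ls-inputs`,
v10) VERBATIM, now as a HYPOTHESIS-FREE tree theorem: it is the assembly `thm61_assembly`
((6.29)–(6.31), registered S2c, `ConreyIwaniec2002Thm61Assembly.lean`) applied to the generic
evaluation `thm61_generic` ((6.4)–(6.12), S2a, `ConreyIwaniec2002Thm61Generic.lean`) and the
shifted-sum evaluation `exists_thm61ShiftedSum` ((6.27)–(6.28), S2b,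
`ConreyIwaniec2002Thm61ShiftedSum.lean`). The theorem is GENERIC in `λ`: it is the mean-value
theorem for Dirichlet polynomials whose coefficients satisfy a shifted-convolution hypothesis, usable
for any such sequence (in the paper it is applied to `λ = λ_ψ` in Proposition 6.4).

WHAT THIS IS NOT: Proposition 6.4 (which needs Theorems 4.3/4.4 for `λ_ψ`), Proposition 8.1, the
class-number consequences, Parity or anything about Landau–Siegel zeros are NOT proved here.
«The programme SEARCHES and TYPES; no claim about Landau–Siegel zeros until a kernel theorem says so.»

## References
* [ConreyIwaniec2002] B. Conrey, H. Iwaniec, Acta Arith. 103 (2002) 259–312: §6 (6.1)–(6.31),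
  Theorem 6.1 (6.36), Corollary 6.2 (6.39).
-/

noncomputable section

open Complex MeasureTheory

namespace Literature.NumberTheory.LFunctions

namespace ConreyIwaniec2002

/-- **Conrey–Iwaniec (2002), Theorem 6.1 / Corollary 6.2 up to (6.31), generic in `λ`,
hypothesis-free** (= the parent stub S2 `stub_theorem61` of SKELETON P64, statement verbatim).
Hypotheses: an admissible kernel `K ≥ 0` (`IsCIKernel K`) with `K ≥ c₀ > 0` on `[1,2]`;
`|λ(n)| ≤ τ(n)` (6.15); `|σ(h)| ≤ C₁σ₋₁(h)` (6.20); the shifted-convolution asymptotics (6.19) with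
constant `B₁` (`ShiftedConvolutionBound lam σ B₁`); a cutoff `a` in the class (6.38)
(`IsCutoff a T Y`); `2 ≤ T ≤ Y ≤ T⁸`. Conclusion = (6.39) with the `Z`-term kept inside
`D = ciD K σ` and `K ≥ c₀𝟙_{[1,2]}` used on the left:
`c₀∫_T^{2T}|Σ a(n)λ(n)n^{-1/2-it}|²dt ≤ L(0)·T·G + 2T∫₀^∞|a(y)|²D(T/y)dy/y`
`  + c(1+B₁)^{1/2}(1+C₁)T⁻¹Y^{15/8}(log Y)⁴`, `G = Σ_n |a(n)λ(n)|²/n`, `L(0) = ciL K 0`.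
Proof: `thm61_assembly` (S2c) applied to `thm61_generic` (S2a) and `exists_thm61ShiftedSum` (S2b).
[cite: ConreyIwaniec2002, Theorem 6.1 (6.36), Corollary 6.2 (6.39), (6.4)–(6.31)] -/
theorem theorem61 :
    ∃ c : ℝ, 0 < c ∧
      ∀ (K : ℝ → ℝ) (c₀ : ℝ), IsCIKernel K → (∀ u, 0 ≤ K u) → 0 < c₀ →
        (∀ u ∈ Set.Icc (1 : ℝ) 2, c₀ ≤ K u) →
          ∀ (lam : ℕ → ℂ) (σ : ℕ → ℝ) (B₁ C₁ : ℝ), 0 ≤ B₁ → 0 ≤ C₁ →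
            (∀ n : ℕ, 1 ≤ n → ‖lam n‖ ≤ (Nat.divisors n).card) →
              (∀ h : ℕ, 1 ≤ h → |σ h| ≤ C₁ * ∑ d ∈ Nat.divisors h, (d : ℝ)⁻¹) →
                ShiftedConvolutionBound lam σ B₁ →
                  ∀ (T Y : ℝ) (a : ℝ → ℂ), 2 ≤ T → T ≤ Y → Y ≤ T ^ (8 : ℕ) → IsCutoff a T Y →
                    c₀ * ∫ t in T..2 * T, ‖LSeries (fun n ↦ a n * lam n) (1 / 2 + t * I)‖ ^ 2 ≤
                      ciL K 0 * T * (∑' n : ℕ, ‖a n * lam n‖ ^ 2 / (n : ℝ)) +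
                        2 * T * (∫ y in Set.Ioi (0 : ℝ), ‖a y‖ ^ 2 * ciD K σ (T / y) / y) +
                        c * (1 + B₁) ^ (1 / 2 : ℝ) * (1 + C₁) * T⁻¹ * Y ^ (15 / 8 : ℝ) *
                          Real.log Y ^ 4 := by
  obtain ⟨ca, hca, ha⟩ := thm61_generic
  obtain ⟨cb, hcb, hb⟩ := exists_thm61ShiftedSum
  exact thm61_assembly ca cb hca hcb ha hb

end ConreyIwaniec2002

end Literature.NumberTheory.LFunctions

end
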